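import Literature.NumberTheory.EllipticCurves.SteinWuthrich2013.MultiplicativeHeightExistence
import Literature.NumberTheory.EllipticCurves.TateCurve.UniformizationThetaZeros
import Literature.NumberTheory.EllipticCurves.TateCurve.UniformizationSeries
import Literature.NumberTheory.EllipticCurves.CanonicalPAdicHeightThetaProofs
import Literature.NumberTheory.EllipticCurves.FormalGroupLawPadicProofs
import HarnessLib

/-!
# Stein–Wuthrich 2013 §4.2 at a multiplicative prime: the theta relation of the Tate sigma
# quantity at rational points FROM Silverman's theta difference formula (ATAEC Prop. V.3.2 (b)(i))
# and a Tate uniformisation of `E(ℚ) ∩ E₁(ℚ_p)` (proofs only)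

Topic `Literature/NumberTheory/EllipticCurves` (cluster `SteinWuthrich2013`); second proof file
(theorems only, nothing asserted, no definition) behind the named facts `exists_isMultCanonical` /
`exists_isSplitMultCanonical` of `MultiplicativeHeightExistence.lean` (existence of SW's §4.2
`p`-adic height datum at a multiplicative prime). Cell `bsd-eis`, seat `bsd-eis-k5-c4` g3 (crux 4
`BSDpOnCellC` of route `EisensteinPrimes`, stmt-BirchSwinnertonDyer-19034, `stub_publishedFacts`
conjuncts `hHs`/`hHn`). HONEST FRAMING: nothing here is a class theorem and nothing here is
"finishing BSD".

The companion `MultiplicativeHeightExistenceProofs.lean` (same seat) reduced both facts to ONE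
analytic input on the Tate sigma quantity
`S(x,y) = uniformisationScaleSq W p q · tateSigmaSq q (coshOfSq (logUnitParamSq W p q x y))`
(`= C²σ_q(u(P))²` for `P = (x,y)`): (`hS0`) `S ≠ 0` at the rational points of `E₁(ℚ_p)` and (`hΘ`)
`S(P+Q)·S(P-Q) = (x(Q) - x(P))²·S(P)²·S(Q)²` at generic rational pairs of `E₁(ℚ_p)`. This file
SPLITS that input into its two printed sources, over an arbitrary complete normed field `K`
receiving `ℚ_p` (`K = ℚ_p` at a split prime, a quadratic extension / `ℂ_p` at a non-split one):

* (V.3.2) Silverman's **theta difference formula** for the Tate curve,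
  `(X(u₁,q) - X(u₂,q)) θ(u₁,q)² θ(u₂,q)² = -u₂ θ(u₁u₂,q) θ(u₁u₂⁻¹,q)` for `u₁, u₂ ∈ K^* ∖ q^ℤ`
  (ATAEC Prop. V.3.2 (b)(i), PDF p. 399; `X = TateCurve.tateX`, `θ = TateCurve.tateTheta`) —
  hypothesis `hV32`;
* (UNIF) a **Tate uniformisation of the rational points of `E₁(ℚ_p)` in SW's coordinates**: a scale
  `C ∈ K^*` with `C² = uniformisationScaleSq W p q` (SW §4.2 "`ψ^*(ω_E) = C du/u`"), a shift `r`,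
  and parameters `υ(P) ∈ K^* ∖ q^ℤ` of the rational points `P = (x,y)` of `E₁(ℚ_p)`, multiplicative
  in `P` (`υ(P+Q) = υ(P)υ(Q)`, `υ(P-Q) = υ(P)υ(Q)⁻¹`), with `X(υ(P),q) = C²x + r` (the point
  `ψ(φ(υ(P))) = P` under `E_q ≅ E ⊗ K`, ATAEC V.3.1/V.5.3) and
  `tateSigmaSq q (coshOfSq (logUnitParamSq W p q x y)) = θ(υ(P),q)²/υ(P)` (SW §4.2: `σ_q(u)² = θ(u)²/u`
  at `u = u(P)`, `(u+u⁻¹)/2 = cosh(log_p u)`, `log_p u(P) = log_E(z(P))/C`) — hypotheses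
  `hC`, `hυ*`.

Main results:

* `tateSigma_ne_zero_of_uniformization` — (UNIF) ⇒ `hS0` (`θ(u,q) ≠ 0` off `q^ℤ`, tree theorem
  `TateCurve.tateTheta_ne_zero`, ATAEC V.3.2 (a));
* `tateSigma_theta_of_uniformization` — (V.3.2) ∧ (UNIF) ⇒ `hΘ`: with `uᵢ = υ(Pᵢ)`,
  `S₃S₄ = C⁴θ(u₁u₂)²θ(u₁u₂⁻¹)²/u₁²` and `δ²S₁²S₂² = δ²C⁸θ₁⁴θ₂⁴/(u₁²u₂²)` agree because
  `C⁴δ²θ₁⁴θ₂⁴ = u₂²θ(u₁u₂)²θ(u₁u₂⁻¹)²` is the square of (V.3.2) with `X(u₁) - X(u₂) = C²δ`;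
* `tateSigma_input_of_uniformization` — both, packaged in the exact shape of the hypothesis of
  `exists_isMultCanonical_of_theta` / `exists_isSplitMultCanonical_of_theta` for one `(W, p, q)`.

So after this file the two named facts rest on: ATAEC Prop. V.3.2 (b)(i) over `K` (printed; proof
"valid over ℂ by (1.3), then as for (3.1c)" = the tree's `q`-transfer machine of
`TateCurve/TateFormalAdditionIdentity.lean`, with the complex identity the tree's theorems
`PeriodPair.weierstrassP_sub_eq_sigma_holds` + `weierstrassSigma_ofUpperHalfPlane_eq_qProduct_holds`)
and the uniformisation data (UNIF) (tree: `TateCurve.uniformization_holds`,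
`exists_tate_eq_of_one_lt_norm`, `exists_variableChange_of_j_eq_of_isSquare_gamma`, the
`FormalGroup*` library for `log_E`).

## Sources

* J. H. Silverman, *Advanced Topics in the Arithmetic of Elliptic Curves* (1994), Prop. V.3.2 (a),
  (b)(i) (PDF p. 399); Thm. V.3.1 (c),(d); Thm. V.5.3. [SilvermanATAEC1994]
* W. Stein, C. Wuthrich, Math. Comp. 82 (2013), §4.2 pp. 15–16 (`C`, `u(P)`, `σ_p(u)`).
  [SteinWuthrich2013]
* B. Mazur, J. Tate, Duke Math. J. 62 (1991), §3 (property IV of `σ`). [MazurTate1991]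

## Design notes

* Pure proof file. `K` is any complete normed field with a ring hom `ι : ℚ_p →+* K` and
  `‖ι q‖ < 1`; all `ℚ_p`-quantities are read in `K` through `ι`, and the conclusions are pulled
  back by injectivity of `ι`.
* The parameters are an arbitrary function `υ : ℚ → ℚ → K` constrained only on the rational points
  of `E₁(ℚ_p)` (no junk values enter).
-/

noncomputable section

open scoped Classical

open WeierstrassCurve Literature.NumberTheory.EllipticCurves
  Literature.NumberTheory.EllipticCurves.TateCurve

namespace Literature.NumberTheory.EllipticCurves.SteinWuthrich2013

variable {W : WeierstrassCurve ℚ} {p : ℕ} [Fact p.Prime]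
  {K : Type*} [NormedField K] [CompleteSpace K]

/-- **`S ≠ 0` on `E(ℚ) ∩ E₁(ℚ_p)` from a Tate uniformisation.** If `C ≠ 0`,
`C² = uniformisationScaleSq W p q` in `K`, and every rational point `P = (x,y)` of `E₁(ℚ_p)` has a
parameter `υ(P) ∈ K^* ∖ q^ℤ` with `tateSigmaSq q (coshOfSq (logUnitParamSq W p q x y)) = θ(υ(P),q)²/υ(P)`,
then `S(P) = C²σ_q(u(P))² ≠ 0` (`θ ≠ 0` off `q^ℤ`, ATAEC V.3.2 (a): `TateCurve.tateTheta_ne_zero`).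
[Silverman ATAEC Prop. V.3.2 (a); Stein–Wuthrich 2013, §4.2]
[cite: SilvermanATAEC1994, Prop. V.3.2 (a) (PDF p. 399)] -/
theorem tateSigma_ne_zero_of_uniformization (ι : ℚ_[p] →+* K) {q : ℚ_[p]} (hq0 : q ≠ 0)
    (hιq : ‖ι q‖ < 1) {C : K} (hC : C ^ 2 = ι (uniformisationScaleSq W p q)) (hC0 : C ≠ 0)
    (υ : ℚ → ℚ → K)
    (hυ0 : ∀ {x y : ℚ} (_ : W.toAffine.Nonsingular x y), 1 < ‖(x : ℚ_[p])‖ →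
      υ x y ≠ 0 ∧ ∀ n : ℤ, υ x y ≠ ι q ^ n)
    (hυσ : ∀ {x y : ℚ} (_ : W.toAffine.Nonsingular x y), 1 < ‖(x : ℚ_[p])‖ →
      ι (tateSigmaSq q (coshOfSq (logUnitParamSq W p q x y))) =
        tateTheta (ι q) (υ x y) ^ 2 / υ x y)
    {x y : ℚ} (h : W.toAffine.Nonsingular x y) (hx : 1 < ‖(x : ℚ_[p])‖) :
    uniformisationScaleSq W p q * tateSigmaSq q (coshOfSq (logUnitParamSq W p q x y)) ≠ 0 := by
  intro h0
  have hιq0 : ι q ≠ 0 := (map_ne_zero ι).mpr hq0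
  obtain ⟨hu0, huq⟩ := hυ0 h hx
  have hθ : tateTheta (ι q) (υ x y) ≠ 0 := tateTheta_ne_zero hιq hιq0 huq
  have h1 := congrArg ι h0
  rw [map_mul, map_zero, ← hC, hυσ h hx] at h1
  exact (mul_ne_zero (pow_ne_zero 2 hC0) (div_ne_zero (pow_ne_zero 2 hθ) hu0)) h1

omit [CompleteSpace K] in
/-- **The theta relation of the Tate sigma quantity at generic rational pairs of `E₁(ℚ_p)` from
Silverman's theta difference formula and a Tate uniformisation.** Over a complete normed field `K`
with `ι : ℚ_p →+* K`, `‖ι q‖ < 1`, assume: (`hV32`) ATAEC Prop. V.3.2 (b)(i)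
`(X(u₁) - X(u₂)) θ(u₁)² θ(u₂)² = -u₂ θ(u₁u₂) θ(u₁u₂⁻¹)` for `u₁, u₂ ∈ K^* ∖ q^ℤ`; a scale `C ≠ 0` with
`C² = uniformisationScaleSq W p q` and a shift `r`; parameters `υ(P) ∈ K^* ∖ q^ℤ` of the rational
points of `E₁(ℚ_p)` with `X(υ(P)) = C²x(P) + r`,
`tateSigmaSq q (coshOfSq (logUnitParamSq W p q x y)) = θ(υ(P))²/υ(P)`, and `υ(P+Q) = υ(P)υ(Q)`,
`υ(P-Q) = υ(P)υ(Q)⁻¹`. Then for rational `P, Q ∈ E₁(ℚ_p)` with `x(P) ≠ x(Q)`, `P + Q = (x₃,y₃)`,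
`P - Q = (x₄,y₄)`: `S(P+Q)·S(P-Q) = (x(Q) - x(P))²·S(P)²·S(Q)²`,
`S(x,y) = uniformisationScaleSq W p q · tateSigmaSq q (coshOfSq (logUnitParamSq W p q x y))`.
Computation: `S₃S₄ = C⁴θ(u₁u₂)²θ(u₁u₂⁻¹)²/u₁²`, `δ²S₁²S₂² = δ²C⁸θ₁⁴θ₂⁴/(u₁²u₂²)`, and
`C⁴δ²θ₁⁴θ₂⁴ = u₂²θ(u₁u₂)²θ(u₁u₂⁻¹)²` is (V.3.2) squared with `X(u₁) - X(u₂) = C²δ`.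
[Silverman ATAEC Prop. V.3.2 (b)(i); Stein–Wuthrich 2013, §4.2; Mazur–Tate 1991, §3 (property IV)]
[cite: SilvermanATAEC1994, Prop. V.3.2 (b)(i) (PDF p. 399)] [cite: SteinWuthrich2013, §4.2 (pp. 15–16)] -/
theorem tateSigma_theta_of_uniformization [W.IsIntegral ℤ] (ι : ℚ_[p] →+* K) {q : ℚ_[p]}
    (hq0 : q ≠ 0)
    (hV32 : ∀ u₁ u₂ : K, u₁ ≠ 0 → u₂ ≠ 0 → (∀ n : ℤ, u₁ ≠ ι q ^ n) → (∀ n : ℤ, u₂ ≠ ι q ^ n) →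
      (tateX (ι q) u₁ - tateX (ι q) u₂) * tateTheta (ι q) u₁ ^ 2 * tateTheta (ι q) u₂ ^ 2 =
        -(u₂ * tateTheta (ι q) (u₁ * u₂) * tateTheta (ι q) (u₁ * u₂⁻¹)))
    {C : K} (r : K) (hC : C ^ 2 = ι (uniformisationScaleSq W p q)) (hC0 : C ≠ 0)
    (υ : ℚ → ℚ → K)
    (hυ0 : ∀ {x y : ℚ} (_ : W.toAffine.Nonsingular x y), 1 < ‖(x : ℚ_[p])‖ →
      υ x y ≠ 0 ∧ ∀ n : ℤ, υ x y ≠ ι q ^ n)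
    (hυX : ∀ {x y : ℚ} (_ : W.toAffine.Nonsingular x y), 1 < ‖(x : ℚ_[p])‖ →
      tateX (ι q) (υ x y) = C ^ 2 * ι (x : ℚ_[p]) + r)
    (hυσ : ∀ {x y : ℚ} (_ : W.toAffine.Nonsingular x y), 1 < ‖(x : ℚ_[p])‖ →
      ι (tateSigmaSq q (coshOfSq (logUnitParamSq W p q x y))) =
        tateTheta (ι q) (υ x y) ^ 2 / υ x y)
    (hυadd : ∀ {x₁ y₁ x₂ y₂ x₃ y₃ : ℚ} (h₁ : W.toAffine.Nonsingular x₁ y₁)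
      (h₂ : W.toAffine.Nonsingular x₂ y₂) (h₃ : W.toAffine.Nonsingular x₃ y₃),
      1 < ‖(x₁ : ℚ_[p])‖ → 1 < ‖(x₂ : ℚ_[p])‖ →
      (.some x₁ y₁ h₁ : W.toAffine.Point) + .some x₂ y₂ h₂ = .some x₃ y₃ h₃ →
        υ x₃ y₃ = υ x₁ y₁ * υ x₂ y₂)
    (hυsub : ∀ {x₁ y₁ x₂ y₂ x₄ y₄ : ℚ} (h₁ : W.toAffine.Nonsingular x₁ y₁)
      (h₂ : W.toAffine.Nonsingular x₂ y₂) (h₄ : W.toAffine.Nonsingular x₄ y₄),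
      1 < ‖(x₁ : ℚ_[p])‖ → 1 < ‖(x₂ : ℚ_[p])‖ →
      (.some x₁ y₁ h₁ : W.toAffine.Point) - .some x₂ y₂ h₂ = .some x₄ y₄ h₄ →
        υ x₄ y₄ = υ x₁ y₁ * (υ x₂ y₂)⁻¹)
    {x₁ y₁ x₂ y₂ x₃ y₃ x₄ y₄ : ℚ} (h₁ : W.toAffine.Nonsingular x₁ y₁)
    (h₂ : W.toAffine.Nonsingular x₂ y₂) (h₃ : W.toAffine.Nonsingular x₃ y₃)
    (h₄ : W.toAffine.Nonsingular x₄ y₄) (hx₁ : 1 < ‖(x₁ : ℚ_[p])‖) (hx₂ : 1 < ‖(x₂ : ℚ_[p])‖)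
    (hS : (.some x₁ y₁ h₁ : W.toAffine.Point) + .some x₂ y₂ h₂ = .some x₃ y₃ h₃)
    (hD : (.some x₁ y₁ h₁ : W.toAffine.Point) - .some x₂ y₂ h₂ = .some x₄ y₄ h₄) :
    (uniformisationScaleSq W p q * tateSigmaSq q (coshOfSq (logUnitParamSq W p q x₃ y₃))) *
        (uniformisationScaleSq W p q * tateSigmaSq q (coshOfSq (logUnitParamSq W p q x₄ y₄))) =
      ((x₂ : ℚ_[p]) - x₁) ^ 2 *
        (uniformisationScaleSq W p q * tateSigmaSq q (coshOfSq (logUnitParamSq W p q x₁ y₁))) ^ 2 *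
        (uniformisationScaleSq W p q * tateSigmaSq q (coshOfSq (logUnitParamSq W p q x₂ y₂))) ^ 2 := by
  have hιq0 : ι q ≠ 0 := (map_ne_zero ι).mpr hq0
  -- `P ± Q ∈ E₁(ℚ_p)` (AEC VII.2.2, the tree's `isInReductionKernel_add` over `ℚ_p`)
  have hx₃ : 1 < ‖(x₃ : ℚ_[p])‖ := by
    have hk := (W.baseChange ℚ_[p]).isInReductionKernel_add
      (P := W.toPadicPoint p (.some x₁ y₁ h₁)) (Q := W.toPadicPoint p (.some x₂ y₂ h₂))
      (by rw [toPadicPoint_some]; exact hx₁) (by rw [toPadicPoint_some]; exact hx₂)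
    rw [← map_add, hS, toPadicPoint_some] at hk
    exact hk
  have hx₄ : 1 < ‖(x₄ : ℚ_[p])‖ := by
    have hk := (W.baseChange ℚ_[p]).isInReductionKernel_add
      (P := W.toPadicPoint p (.some x₁ y₁ h₁)) (Q := W.toPadicPoint p (-(.some x₂ y₂ h₂)))
      (by rw [toPadicPoint_some]; exact hx₁)
      (by rw [map_neg, toPadicPoint_some, Affine.Point.neg_some]; exact hx₂)
    rw [← map_add, ← sub_eq_add_neg, hD, toPadicPoint_some] at hk
    exact hk
  -- parameters
  obtain ⟨hu₁, hu₁q⟩ := hυ0 h₁ hx₁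
  obtain ⟨hu₂, hu₂q⟩ := hυ0 h₂ hx₂
  set u₁ := υ x₁ y₁ with hu₁def
  set u₂ := υ x₂ y₂ with hu₂def
  have hu₃ : υ x₃ y₃ = u₁ * u₂ := hυadd h₁ h₂ h₃ hx₁ hx₂ hS
  have hu₄ : υ x₄ y₄ = u₁ * u₂⁻¹ := hυsub h₁ h₂ h₄ hx₁ hx₂ hD
  -- Silverman V.3.2 (b)(i) at `(u₁, u₂)`, with `X(u₁) - X(u₂) = C²(x₁ - x₂)`
  have hV := hV32 u₁ u₂ hu₁ hu₂ hu₁q hu₂q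
  rw [hυX h₁ hx₁, hυX h₂ hx₂] at hV
  -- apply `ι` and compute
  apply ι.injective
  simp only [map_mul, map_pow, map_sub]
  rw [← hC, hυσ h₁ hx₁, hυσ h₂ hx₂, hυσ h₃ hx₃, hυσ h₄ hx₄, hu₃, hu₄, ← hu₁def, ← hu₂def]
  set θ₁ := tateTheta (ι q) u₁ with hθ₁def
  set θ₂ := tateTheta (ι q) u₂ with hθ₂def
  set A := tateTheta (ι q) (u₁ * u₂) with hAdef
  set B := tateTheta (ι q) (u₁ * u₂⁻¹) with hBdef
  set a₁ := ι (x₁ : ℚ_[p]) with ha₁def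
  set a₂ := ι (x₂ : ℚ_[p]) with ha₂def
  have hsq : (C ^ 2 * a₁ + r - (C ^ 2 * a₂ + r)) ^ 2 * θ₁ ^ 4 * θ₂ ^ 4 = u₂ ^ 2 * A ^ 2 * B ^ 2 := by
    have := congrArg (fun t => t ^ 2) hV
    linear_combination this
  rw [show C ^ 2 * (A ^ 2 / (u₁ * u₂)) * (C ^ 2 * (B ^ 2 / (u₁ * u₂⁻¹))) =
    C ^ 4 * A ^ 2 * B ^ 2 / u₁ ^ 2 by field_simp]
  rw [show (a₂ - a₁) ^ 2 * (C ^ 2 * (θ₁ ^ 2 / u₁)) ^ 2 * (C ^ 2 * (θ₂ ^ 2 / u₂)) ^ 2 =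
    C ^ 4 * ((a₂ - a₁) ^ 2 * C ^ 4 * θ₁ ^ 4 * θ₂ ^ 4) / (u₁ ^ 2 * u₂ ^ 2) by field_simp]
  rw [show (a₂ - a₁) ^ 2 * C ^ 4 * θ₁ ^ 4 * θ₂ ^ 4 = u₂ ^ 2 * A ^ 2 * B ^ 2 by
    linear_combination hsq]
  field_simp

/-- **The analytic input of `exists_isMultCanonical_of_theta` / `exists_isSplitMultCanonical_of_theta`
for one `(W, p, q)`, from Silverman's theta difference formula over `K` and a Tate uniformisation
of `E(ℚ) ∩ E₁(ℚ_p)` in SW's coordinates** (packaging of `tateSigma_ne_zero_of_uniformization` and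
`tateSigma_theta_of_uniformization`). [Silverman ATAEC Prop. V.3.2; Stein–Wuthrich 2013, §4.2]
[cite: SilvermanATAEC1994, Prop. V.3.2 (b)(i) (PDF p. 399)] [cite: SteinWuthrich2013, §4.2 (pp. 15–16)] -/
theorem tateSigma_input_of_uniformization [W.IsIntegral ℤ] (ι : ℚ_[p] →+* K) {q : ℚ_[p]}
    (hq0 : q ≠ 0) (hιq : ‖ι q‖ < 1)
    (hV32 : ∀ u₁ u₂ : K, u₁ ≠ 0 → u₂ ≠ 0 → (∀ n : ℤ, u₁ ≠ ι q ^ n) → (∀ n : ℤ, u₂ ≠ ι q ^ n) →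
      (tateX (ι q) u₁ - tateX (ι q) u₂) * tateTheta (ι q) u₁ ^ 2 * tateTheta (ι q) u₂ ^ 2 =
        -(u₂ * tateTheta (ι q) (u₁ * u₂) * tateTheta (ι q) (u₁ * u₂⁻¹)))
    {C : K} (r : K) (hC : C ^ 2 = ι (uniformisationScaleSq W p q)) (hC0 : C ≠ 0)
    (υ : ℚ → ℚ → K)
    (hυ0 : ∀ {x y : ℚ} (_ : W.toAffine.Nonsingular x y), 1 < ‖(x : ℚ_[p])‖ →
      υ x y ≠ 0 ∧ ∀ n : ℤ, υ x y ≠ ι q ^ n)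
    (hυX : ∀ {x y : ℚ} (_ : W.toAffine.Nonsingular x y), 1 < ‖(x : ℚ_[p])‖ →
      tateX (ι q) (υ x y) = C ^ 2 * ι (x : ℚ_[p]) + r)
    (hυσ : ∀ {x y : ℚ} (_ : W.toAffine.Nonsingular x y), 1 < ‖(x : ℚ_[p])‖ →
      ι (tateSigmaSq q (coshOfSq (logUnitParamSq W p q x y))) =
        tateTheta (ι q) (υ x y) ^ 2 / υ x y)
    (hυadd : ∀ {x₁ y₁ x₂ y₂ x₃ y₃ : ℚ} (h₁ : W.toAffine.Nonsingular x₁ y₁)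
      (h₂ : W.toAffine.Nonsingular x₂ y₂) (h₃ : W.toAffine.Nonsingular x₃ y₃),
      1 < ‖(x₁ : ℚ_[p])‖ → 1 < ‖(x₂ : ℚ_[p])‖ →
      (.some x₁ y₁ h₁ : W.toAffine.Point) + .some x₂ y₂ h₂ = .some x₃ y₃ h₃ →
        υ x₃ y₃ = υ x₁ y₁ * υ x₂ y₂)
    (hυsub : ∀ {x₁ y₁ x₂ y₂ x₄ y₄ : ℚ} (h₁ : W.toAffine.Nonsingular x₁ y₁)
      (h₂ : W.toAffine.Nonsingular x₂ y₂) (h₄ : W.toAffine.Nonsingular x₄ y₄),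
      1 < ‖(x₁ : ℚ_[p])‖ → 1 < ‖(x₂ : ℚ_[p])‖ →
      (.some x₁ y₁ h₁ : W.toAffine.Point) - .some x₂ y₂ h₂ = .some x₄ y₄ h₄ →
        υ x₄ y₄ = υ x₁ y₁ * (υ x₂ y₂)⁻¹) :
    (∀ {x y : ℚ} (_ : W.toAffine.Nonsingular x y), 1 < ‖(x : ℚ_[p])‖ →
      uniformisationScaleSq W p q * tateSigmaSq q (coshOfSq (logUnitParamSq W p q x y)) ≠ 0) ∧
    (∀ {x₁ y₁ x₂ y₂ x₃ y₃ x₄ y₄ : ℚ} (h₁ : W.toAffine.Nonsingular x₁ y₁)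
      (h₂ : W.toAffine.Nonsingular x₂ y₂) (h₃ : W.toAffine.Nonsingular x₃ y₃)
      (h₄ : W.toAffine.Nonsingular x₄ y₄), 1 < ‖(x₁ : ℚ_[p])‖ → 1 < ‖(x₂ : ℚ_[p])‖ → x₁ ≠ x₂ →
      (.some x₁ y₁ h₁ : W.toAffine.Point) + .some x₂ y₂ h₂ = .some x₃ y₃ h₃ →
      (.some x₁ y₁ h₁ : W.toAffine.Point) - .some x₂ y₂ h₂ = .some x₄ y₄ h₄ →
        (uniformisationScaleSq W p q * tateSigmaSq q (coshOfSq (logUnitParamSq W p q x₃ y₃))) *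
            (uniformisationScaleSq W p q * tateSigmaSq q (coshOfSq (logUnitParamSq W p q x₄ y₄))) =
          ((x₂ : ℚ_[p]) - x₁) ^ 2 *
            (uniformisationScaleSq W p q * tateSigmaSq q (coshOfSq (logUnitParamSq W p q x₁ y₁))) ^ 2 *
            (uniformisationScaleSq W p q *
              tateSigmaSq q (coshOfSq (logUnitParamSq W p q x₂ y₂))) ^ 2) :=
  ⟨fun h hx => tateSigma_ne_zero_of_uniformization ι hq0 hιq hC hC0 υ hυ0 hυσ h hx,
    fun h₁ h₂ h₃ h₄ hx₁ hx₂ _ hS hD =>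
      tateSigma_theta_of_uniformization ι hq0 hV32 r hC hC0 υ hυ0 hυX hυσ hυadd hυsub h₁ h₂ h₃
        h₄ hx₁ hx₂ hS hD⟩

end Literature.NumberTheory.EllipticCurves.SteinWuthrich2013

end
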